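import Literature.MathematicalPhysics.QuantumManyBody.PeriodicFormDomain
import Literature.MathematicalPhysics.QuantumManyBody.BogoliubovSpectrumGP
import Literature.MathematicalPhysics.QuantumManyBody.TorusFockSectorDictionary
import Literature.MathematicalPhysics.QuantumManyBody.PeriodicBoseGasMomentumSector
import HarnessLib

/-!
# The two lowest eigenvalues of the periodic `N`-body Hamiltonian: `periodicGroundStateEnergy` and
# `kyFanTwo` are form eigenvalues

Topic `Literature/MathematicalPhysics/QuantumManyBody`, sequel of `PeriodicFormDomain.lean` (the form
domain `Q = formDomain` of `q(Ψ) = ∫ |∇Ψ|² + W|Ψ|²`, `W = ∑_{i<j} v^per(xᵢ - xⱼ)`, with its injective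
compact embedding `ι = formEmbed : Q →L[ℂ] L²((ℝ/ℤ)^{3N})`) and of
`Literature/Analysis/InnerProduct/CompactEmbeddingKyFanTwo.lean` (the two top eigenpairs
`(κ₁, e₁), (κ₂, e₂)` of the Gram operator `ι†ι`, `TwoModeData`). Written for the provefact
`Literature.MathematicalPhysics.QuantumManyBody.BoseGas.BoccatoEtAl2019Acta_firstExcitation`
([BoccatoEtAl2019Acta, Thm. 1.1 (ii)], whose proof §6 is the min–max principle for `m ≤ 2`
applied to the `N`-body Hamiltonian on the torus).

**Main results** (for `0 < L`, `1 ≤ N`, `v` measurable with `W ∈ L¹` of the cell; all proved).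
* `exists_orthogonal_formEmbed`, `nonempty_twoModeData` — the spectral data `d : TwoModeData (formEmbed …)`
  exist (the constant function and a symmetrised plane wave are `L²`-orthogonal core functions;
  Rellich `isCompactOperator_formEmbed`).
* `periodicGroundStateEnergy_eq_ofReal` — **the variational ground-state energy is the lowest form
  eigenvalue**: `periodicGroundStateEnergy v N L = E₁`, `E₁ = κ₁⁻¹ - 1 ≥ 0`, attained at the
  eigenvector `d.φ₁ ∈ Q` [ReedSimonIV1978, Thm. XIII.1].
* `kyFanTwo_eq_ofReal` — **Ky Fan for `m = 2`**: `kyFanTwo v N L = E₁ + E₂`, `E₂ = κ₂⁻¹ - 1 ≥ E₁`, the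
  sum of the two lowest eigenvalues counted with multiplicity, attained at the `L²`-orthonormal
  eigenvectors `d.φ₁, d.φ₂` [ReedSimonIV1978, Thm. XIII.1–2; BoccatoEtAl2019Acta, §6 (`λ₁, λ₂`)].
  In the notation of [BoccatoEtAl2019Acta, §6]: `θ₁ = E₁ = E_N` and `θ₁ + θ₂ = kyFanTwo`, so the
  first excitation energy `θ₂ - θ₁` of the source is `kyFanTwo - 2·periodicGroundStateEnergy`.
* The dictionary lemmas `le_periodicEnergy_of_twoModeData`, `le_add_periodicEnergy_of_twoModeData`
  (lower bounds for every trial state / orthogonal pair) and `PeriodicTrialState.ofCore`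
  (normalised core functions are trial states).

## References
* [BoccatoEtAl2019Acta] Boccato–Brennecke–Cenatiempo–Schlein, Acta Math. 222 (2019), §6.
* [ReedSimonIV1978] Reed–Simon IV, Thm. XIII.1–XIII.2 (min–max), XIII.64 (compact resolvent).
-/

noncomputable section

open MeasureTheory Filter Set WithLp Complex UnitAddTorus Literature.Analysis.InnerProduct
open scoped ENNReal NNReal Topology ComplexConjugate InnerProductSpace

namespace Literature.MathematicalPhysics.QuantumManyBody.BoseGas

/-- As in `PeriodicConfigFourier.lean`: the measure on `ℝ/ℤ` is the Haar probability measure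
(local instance, definitionally that of `PeriodicFormDomain.lean`). [folklore] -/
local instance formSpectrum_measureSpace : MeasureSpace UnitAddCircle := ⟨AddCircle.haarAddCircle⟩

/-- The measure on `ℝ/ℤ` is a probability measure. [folklore] -/
local instance formSpectrum_isProbabilityMeasure : IsProbabilityMeasure (volume : Measure UnitAddCircle) :=
  inferInstanceAs (IsProbabilityMeasure AddCircle.haarAddCircle)

/-- The measure on `(ℝ/ℤ)^D` is a probability measure. [folklore] -/
local instance formSpectrum_isProbabilityMeasure_pi {D : Type*} [Fintype D] :
    IsProbabilityMeasure (volume : Measure (UnitAddTorus D)) := by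
  rw [volume_pi]; infer_instance

variable {N : ℕ} {L : ℝ} {v : ℝ → ℝ≥0∞}

/-- The form domain is complete: a closed subspace of the Hilbert space `⨁_c L²((ℝ/ℤ)^{3N})`
(instance for the `def` `formDomain`, which typeclass search does not unfold). [folklore] -/
instance formDomain.instCompleteSpace (hL : 0 < L) (hv : Measurable v)
    (hW : ∫⁻ X in cellN N L, periodicInteraction v L X ≠ ⊤) : CompleteSpace (formDomain hL hv hW) :=
  inferInstanceAs (CompleteSpace (LinearMap.range (graphEmbed hL hv hW)).topologicalClosure)

/-! ### Two orthogonal core functions -/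

/-- Constants lie in the core. [folklore] -/
theorem const_mem_periodicCore (N : ℕ) (L : ℝ) (c : ℂ) : (fun _ : Config N => c) ∈ periodicCore N L :=
  ⟨contDiff_const, fun _ _ _ => rfl, fun _ _ => rfl⟩

/-- The symmetrised plane waves `N_k 1 = ∑ⱼ e_n(xⱼ)` lie in the core. [folklore] -/
theorem planeWaveSum_mem_periodicCore (hL : L ≠ 0) (n : Fin 3 → ℤ) :
    planeWaveSum (M := N) L n ∈ periodicCore N L :=
  ⟨contDiff_planeWaveSum L n, planeWaveSum_periodic hL n, planeWaveSum_symm L n⟩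

/-- A continuous function is integrable on the cell `[0,L)^{3N}`. [folklore] -/
theorem integrableOn_cellN_of_continuous (L : ℝ) {f : Config N → ℂ} (hf : Continuous f) :
    IntegrableOn f (cellN N L) volume :=
  (hf.continuousOn.integrableOn_compact (isCompact_closedBoxN N L)).mono_set (cellN_subset_closedBoxN N L)

/-- `∫_{[0,L)^{3N}} N_k 1 = 0` for `n ≠ 0` (orthogonality of the plane waves on the cell). [folklore] -/
theorem integral_cellN_planeWaveSum (hL : 0 < L) {n : Fin 3 → ℤ} (hn : n ≠ 0) :
    ∫ X in cellN N L, planeWaveSum L n X = 0 := by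
  have hcont : ∀ j : Fin N, Continuous fun X : Config N => cellWave L n (X j) := fun j =>
    (contDiff_cellWave L n).continuous.comp (continuous_apply j)
  unfold planeWaveSum
  rw [integral_finsetSum _ fun j _ => integrableOn_cellN_of_continuous L (hcont j)]
  refine Finset.sum_eq_zero fun j _ => ?_
  have h := integral_cellN_prod_cellWave hL (n := N) (Pi.single j n)
  have hprod : ∀ X : Config N, ∏ i, cellWave L ((Pi.single j n : Fin N → (Fin 3 → ℤ)) i) (X i) =
      cellWave L n (X j) := fun X => by
    rw [Finset.prod_eq_single j]
    · rw [Pi.single_eq_same]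
    · intro i _ hi
      rw [Pi.single_eq_of_ne hi, cellWave_zero]
    · intro h; exact absurd (Finset.mem_univ j) h
  simp_rw [hprod] at h
  rw [h, if_neg]
  exact fun h0 => hn (Pi.single_eq_zero_iff.1 h0)

/-- Local notation for the Hilbert space `H = L²((ℝ/ℤ)^{3N})`. -/
local notation "L2T " N':max => Lp ℂ 2 (volume : Measure (UnitAddTorus (Fin N' × Fin 3)))

/-- `‖ι(graphEmbed 1)‖² = L^{3N}`: the constant function has non-zero image. [folklore] -/
theorem norm_formEmbed_graphEmbed_const_sq (hL : 0 < L) (hv : Measurable v)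
    (hW : ∫⁻ X in cellN N L, periodicInteraction v L X ≠ ⊤) :
    ‖formEmbed hL hv hW ⟨graphEmbed hL hv hW ⟨fun _ => (1 : ℂ), const_mem_periodicCore N L 1⟩,
      graphEmbed_mem_formDomain hL hv hW _⟩‖ ^ 2 = (L ^ 3) ^ N := by
  rw [norm_formEmbed_graphEmbed_sq]
  show (∫⁻ X in cellN N L, ((‖(1 : ℂ)‖₊ : ℝ≥0∞)) ^ 2).toReal = (L ^ 3) ^ N
  rw [nnnorm_one, ENNReal.coe_one, one_pow, setLIntegral_const, one_mul, volume_cellN,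
    ENNReal.toReal_pow, ENNReal.toReal_pow, ENNReal.toReal_ofReal hL.le]

/-- **Two `L²`-orthogonal core functions with non-zero images** (`N ≥ 1`): the constant `1` and the
symmetrised plane wave `∑ⱼ e_n(xⱼ)`, `n ≠ 0`. [folklore] -/
theorem exists_orthogonal_formEmbed (hL : 0 < L) (hv : Measurable v)
    (hW : ∫⁻ X in cellN N L, periodicInteraction v L X ≠ ⊤) (hN : 0 < N) :
    ∃ x y : formDomain hL hv hW, ⟪formEmbed hL hv hW x, formEmbed hL hv hW y⟫_ℂ = 0 ∧
      formEmbed hL hv hW x ≠ 0 ∧ formEmbed hL hv hW y ≠ 0 := by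
  set n₀ : Fin 3 → ℤ := fun _ => 1 with hn₀
  have hn₀' : n₀ ≠ 0 := fun h => by simpa [hn₀] using congrFun h 0
  set Ψ : periodicCore N L := ⟨fun _ => (1 : ℂ), const_mem_periodicCore N L 1⟩ with hΨ
  set Φ : periodicCore N L := ⟨planeWaveSum L n₀, planeWaveSum_mem_periodicCore hL.ne' n₀⟩ with hΦ
  refine ⟨⟨graphEmbed hL hv hW Ψ, graphEmbed_mem_formDomain hL hv hW Ψ⟩,
    ⟨graphEmbed hL hv hW Φ, graphEmbed_mem_formDomain hL hv hW Φ⟩, ?_, ?_, ?_⟩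
  · rw [inner_formEmbed_graphEmbed]
    show ∫ X in cellN N L, conj (1 : ℂ) * planeWaveSum L n₀ X = 0
    simp only [map_one, one_mul]
    exact integral_cellN_planeWaveSum hL hn₀'
  · intro h0
    have h := norm_formEmbed_graphEmbed_const_sq hL hv hW (N := N)
    rw [h0, norm_zero, zero_pow two_ne_zero] at h
    exact absurd h.symm (by positivity)
  · intro h0
    have h := norm_formEmbed_graphEmbed_sq hL hv hW Φ
    rw [h0, norm_zero, zero_pow two_ne_zero] at h
    rcases (ENNReal.toReal_eq_zero_iff _).1 h.symm with h1 | h1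
    · exact lintegral_planeWaveSum_ne_zero hL hN n₀ h1
    · exact lintegral_planeWaveSum_ne_top (M := N) L n₀ h1

/-- **The spectral data of the two lowest eigenvalues exist** for the periodic `N`-body form
(`N ≥ 1`, `L > 0`, `W ∈ L¹` of the cell): `Literature.Analysis.InnerProduct.exists_twoModeData`
applied to the compact embedding `formEmbed`. [cite: ReedSimonIV1978, Thm. XIII.64] -/
theorem nonempty_twoModeData (hL : 0 < L) (hv : Measurable v)
    (hW : ∫⁻ X in cellN N L, periodicInteraction v L X ≠ ⊤) (hN : 0 < N) :
    Nonempty (TwoModeData (formEmbed hL hv hW)) :=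
  exists_twoModeData _ (isCompactOperator_formEmbed hL hv hW) (exists_orthogonal_formEmbed hL hv hW hN)

/-! ### The dictionary between `TwoModeData` and the variational energies -/

/-- `‖ι ξ‖ ≤ ‖ξ‖_Q` (the value component of the graph norm). [folklore] -/
theorem norm_formEmbed_le (hL : 0 < L) (hv : Measurable v)
    (hW : ∫⁻ X in cellN N L, periodicInteraction v L X ≠ ⊤) (ξ : formDomain hL hv hW) :
    ‖formEmbed hL hv hW ξ‖ ≤ ‖ξ‖ := by
  rw [formEmbed_apply]
  exact PiLp.norm_apply_le _ _

/-- `κ₁ ≤ 1`, i.e. the lowest form eigenvalue `E₁ = κ₁⁻¹ - 1` is non-negative. [folklore] -/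
theorem twoModeData_κ₁_le_one {hL : 0 < L} {hv : Measurable v}
    {hW : ∫⁻ X in cellN N L, periodicInteraction v L X ≠ ⊤} (d : TwoModeData (formEmbed hL hv hW)) :
    d.κ₁ ≤ 1 := by
  have h1 := d.norm_map_e₁_sq
  have h2 := norm_formEmbed_le hL hv hW d.e₁
  rw [d.norm_e₁] at h2
  calc d.κ₁ = ‖formEmbed hL hv hW d.e₁‖ ^ 2 := h1.symm
    _ ≤ 1 ^ 2 := by gcongr
    _ = 1 := one_pow 2

/-- `1 ≤ κ₁⁻¹` (`E₁ = κ₁⁻¹ - 1 ≥ 0`). [folklore] -/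
theorem twoModeData_one_le_inv_κ₁ {hL : 0 < L} {hv : Measurable v}
    {hW : ∫⁻ X in cellN N L, periodicInteraction v L X ≠ ⊤} (d : TwoModeData (formEmbed hL hv hW)) :
    1 ≤ d.κ₁⁻¹ :=
  (one_le_inv₀ d.κ₁_pos).2 (twoModeData_κ₁_le_one d)

/-- `1 ≤ κ₂⁻¹` (`E₂ = κ₂⁻¹ - 1 ≥ 0`). [folklore] -/
theorem twoModeData_one_le_inv_κ₂ {hL : 0 < L} {hv : Measurable v}
    {hW : ∫⁻ X in cellN N L, periodicInteraction v L X ≠ ⊤} (d : TwoModeData (formEmbed hL hv hW)) :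
    1 ≤ d.κ₂⁻¹ :=
  (one_le_inv₀ d.κ₂_pos).2 (d.κ₂_le_κ₁.trans (twoModeData_κ₁_le_one d))

/-- **A normalised core function is a periodic trial state**: if `‖ι(graphEmbed Φ)‖ = 1` then `Φ`,
with its `C¹`/periodicity/symmetry data, is a `PeriodicTrialState`. [folklore] -/
def PeriodicTrialState.ofCore (hL : 0 < L) (hv : Measurable v)
    (hW : ∫⁻ X in cellN N L, periodicInteraction v L X ≠ ⊤) (Φ : periodicCore N L)
    (h1 : ‖formEmbed hL hv hW ⟨graphEmbed hL hv hW Φ, graphEmbed_mem_formDomain hL hv hW Φ⟩‖ = 1) :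
    PeriodicTrialState N L where
  ψ := Φ
  contDiff := Φ.2.1
  periodic := Φ.2.2.1
  symm := Φ.2.2.2
  norm_eq := by
    have h := norm_formEmbed_graphEmbed_sq hL hv hW Φ
    rw [h1, one_pow] at h
    exact (ENNReal.toReal_eq_one_iff _).1 h.symm

/-- The energy of the trial state of a normalised core function: `periodicEnergy = ‖graphEmbed Φ‖² - 1`.
[folklore] -/
theorem periodicEnergy_ofCore (hL : 0 < L) (hv : Measurable v)
    (hW : ∫⁻ X in cellN N L, periodicInteraction v L X ≠ ⊤) (Φ : periodicCore N L)
    (h1 : ‖formEmbed hL hv hW ⟨graphEmbed hL hv hW Φ, graphEmbed_mem_formDomain hL hv hW Φ⟩‖ = 1) :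
    periodicEnergy v (PeriodicTrialState.ofCore hL hv hW Φ h1) =
      ENNReal.ofReal (‖graphEmbed hL hv hW Φ‖ ^ 2 - 1) := by
  have h := norm_graphEmbed_sq_trialState hL hv hW (PeriodicTrialState.ofCore hL hv hW Φ h1)
  have hΦ : (⟨(PeriodicTrialState.ofCore hL hv hW Φ h1).ψ,
      (PeriodicTrialState.ofCore hL hv hW Φ h1).mem_periodicCore⟩ : periodicCore N L) = Φ := rfl
  rw [hΦ] at h
  have hfin : periodicEnergy v (PeriodicTrialState.ofCore hL hv hW Φ h1) ≠ ⊤ :=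
    (lintegral_energy_lt_top hv hW Φ.2.1).ne
  rw [h, add_sub_cancel_left, ENNReal.ofReal_toReal hfin]

/-- **Every trial state has energy at least `E₁ = κ₁⁻¹ - 1`.** [cite: ReedSimonIV1978, Thm. XIII.1] -/
theorem le_periodicEnergy_of_twoModeData {hL : 0 < L} {hv : Measurable v}
    {hW : ∫⁻ X in cellN N L, periodicInteraction v L X ≠ ⊤} (d : TwoModeData (formEmbed hL hv hW))
    (Ψ : PeriodicTrialState N L) : ENNReal.ofReal (d.κ₁⁻¹ - 1) ≤ periodicEnergy v Ψ := by
  have h1 := norm_formEmbed_graphEmbed_trialState hL hv hW Ψ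
  have h2 := d.le_norm_sq h1
  change d.κ₁⁻¹ ≤ ‖graphEmbed hL hv hW ⟨Ψ.ψ, Ψ.mem_periodicCore⟩‖ ^ 2 at h2
  rw [norm_graphEmbed_sq_trialState] at h2
  calc ENNReal.ofReal (d.κ₁⁻¹ - 1) ≤ ENNReal.ofReal (periodicEnergy v Ψ).toReal :=
        ENNReal.ofReal_le_ofReal (by linarith)
    _ ≤ periodicEnergy v Ψ := ENNReal.ofReal_toReal_le

/-- **Every `L²`-orthogonal pair of trial states has total energy at least `E₁ + E₂ = κ₁⁻¹ + κ₂⁻¹ - 2`**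
(Ky Fan's inequality, `Literature.Analysis.InnerProduct.TwoModeData.kyFan_two_le`).
[cite: ReedSimonIV1978, Thm. XIII.1–2] -/
theorem le_add_periodicEnergy_of_twoModeData {hL : 0 < L} {hv : Measurable v}
    {hW : ∫⁻ X in cellN N L, periodicInteraction v L X ≠ ⊤} (d : TwoModeData (formEmbed hL hv hW))
    (Ψ₁ Ψ₂ : PeriodicTrialState N L) (horth : ∫ X in cellN N L, conj (Ψ₁.ψ X) * Ψ₂.ψ X = 0) :
    ENNReal.ofReal (d.κ₁⁻¹ + d.κ₂⁻¹ - 2) ≤ periodicEnergy v Ψ₁ + periodicEnergy v Ψ₂ := by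
  have h1 := norm_formEmbed_graphEmbed_trialState hL hv hW Ψ₁
  have h2 := norm_formEmbed_graphEmbed_trialState hL hv hW Ψ₂
  have h12 : ⟪formEmbed hL hv hW ⟨graphEmbed hL hv hW ⟨Ψ₁.ψ, Ψ₁.mem_periodicCore⟩,
      graphEmbed_mem_formDomain hL hv hW _⟩, formEmbed hL hv hW ⟨graphEmbed hL hv hW
      ⟨Ψ₂.ψ, Ψ₂.mem_periodicCore⟩, graphEmbed_mem_formDomain hL hv hW _⟩⟫_ℂ = 0 := by
    rw [inner_formEmbed_graphEmbed]; exact horth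
  have h := d.kyFan_two_le h1 h2 h12
  change d.κ₁⁻¹ + d.κ₂⁻¹ ≤ ‖graphEmbed hL hv hW ⟨Ψ₁.ψ, Ψ₁.mem_periodicCore⟩‖ ^ 2 +
    ‖graphEmbed hL hv hW ⟨Ψ₂.ψ, Ψ₂.mem_periodicCore⟩‖ ^ 2 at h
  rw [norm_graphEmbed_sq_trialState, norm_graphEmbed_sq_trialState] at h
  calc ENNReal.ofReal (d.κ₁⁻¹ + d.κ₂⁻¹ - 2)
      ≤ ENNReal.ofReal ((periodicEnergy v Ψ₁).toReal + (periodicEnergy v Ψ₂).toReal) :=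
        ENNReal.ofReal_le_ofReal (by linarith)
    _ = ENNReal.ofReal (periodicEnergy v Ψ₁).toReal + ENNReal.ofReal (periodicEnergy v Ψ₂).toReal :=
        ENNReal.ofReal_add ENNReal.toReal_nonneg ENNReal.toReal_nonneg
    _ ≤ periodicEnergy v Ψ₁ + periodicEnergy v Ψ₂ := add_le_add ENNReal.ofReal_toReal_le ENNReal.ofReal_toReal_le

/-- Elements of the core subspace of `Q` come from core functions. [folklore] -/
theorem exists_eq_graphEmbed_of_mem_coreRange {hL : 0 < L} {hv : Measurable v}
    {hW : ∫⁻ X in cellN N L, periodicInteraction v L X ≠ ⊤} {ψ : formDomain hL hv hW}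
    (hψ : ψ ∈ coreRange hL hv hW) :
    ∃ Φ : periodicCore N L, ψ = ⟨graphEmbed hL hv hW Φ, graphEmbed_mem_formDomain hL hv hW Φ⟩ := by
  obtain ⟨Φ, hΦ⟩ := hψ
  exact ⟨Φ, Subtype.ext hΦ.symm⟩

/-- **The variational ground-state energy is the lowest form eigenvalue**:
`periodicGroundStateEnergy v N L = κ₁⁻¹ - 1 (= E₁ ≥ 0)` for any `TwoModeData` of the embedding; in
particular it is attained (at `d.φ₁ ∈ Q`) and is an eigenvalue of the form.
[cite: ReedSimonIV1978, Thm. XIII.1] -/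
theorem periodicGroundStateEnergy_eq_ofReal {hL : 0 < L} {hv : Measurable v}
    {hW : ∫⁻ X in cellN N L, periodicInteraction v L X ≠ ⊤} (d : TwoModeData (formEmbed hL hv hW)) :
    periodicGroundStateEnergy v N L = ENNReal.ofReal (d.κ₁⁻¹ - 1) := by
  refine le_antisymm ?_ (le_iInf fun Ψ => le_periodicEnergy_of_twoModeData d Ψ)
  refine ENNReal.le_of_forall_pos_le_add fun ε hε _ => ?_
  obtain ⟨ψ, hψS, hψ1, hlt⟩ := d.exists_lt_of_dense (dense_coreRange hL hv hW) (ε := ε) (by exact_mod_cast hε)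
  obtain ⟨Φ, rfl⟩ := exists_eq_graphEmbed_of_mem_coreRange hψS
  calc periodicGroundStateEnergy v N L ≤ periodicEnergy v (PeriodicTrialState.ofCore hL hv hW Φ hψ1) := iInf_le _ _
    _ = ENNReal.ofReal (‖graphEmbed hL hv hW Φ‖ ^ 2 - 1) := periodicEnergy_ofCore hL hv hW Φ hψ1
    _ ≤ ENNReal.ofReal (d.κ₁⁻¹ - 1 + ε) := ENNReal.ofReal_le_ofReal (by
        change ‖graphEmbed hL hv hW Φ‖ ^ 2 < d.κ₁⁻¹ + ε at hlt
        linarith)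
    _ = ENNReal.ofReal (d.κ₁⁻¹ - 1) + ε := by
        rw [ENNReal.ofReal_add (by linarith [twoModeData_one_le_inv_κ₁ d]) ε.coe_nonneg, ENNReal.ofReal_coe_nnreal]

/-- **Ky Fan's principle for the periodic `N`-body Hamiltonian (`m = 2`)**:
`kyFanTwo v N L = κ₁⁻¹ + κ₂⁻¹ - 2 = E₁ + E₂`, the sum of the two lowest eigenvalues (with multiplicity)
of the form, attained at the `L²`-orthonormal eigenvectors `d.φ₁, d.φ₂ ∈ Q`. This is the
identification `θ₁ + θ₂ = inf {⟨Ψ₁,HΨ₁⟩ + ⟨Ψ₂,HΨ₂⟩ : Ψ₁ ⊥ Ψ₂}` over the `C¹` form core used in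
[BoccatoEtAl2019Acta, §6] (`m = 2`). [cite: ReedSimonIV1978, Thm. XIII.1–2] -/
theorem kyFanTwo_eq_ofReal {hL : 0 < L} {hv : Measurable v}
    {hW : ∫⁻ X in cellN N L, periodicInteraction v L X ≠ ⊤} (d : TwoModeData (formEmbed hL hv hW)) :
    kyFanTwo v N L = ENNReal.ofReal (d.κ₁⁻¹ + d.κ₂⁻¹ - 2) := by
  refine le_antisymm ?_ (le_iInf fun Ψ₁ => le_iInf fun Ψ₂ => le_iInf fun horth =>
    le_add_periodicEnergy_of_twoModeData d Ψ₁ Ψ₂ horth)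
  refine ENNReal.le_of_forall_pos_le_add fun ε hε _ => ?_
  obtain ⟨ψ₁, hψ₁S, ψ₂, hψ₂S, h₁, h₂, h₁₂, hlt⟩ :=
    d.exists_pair_lt_of_dense (dense_coreRange hL hv hW) (ε := ε) (by exact_mod_cast hε)
  obtain ⟨Φ₁, rfl⟩ := exists_eq_graphEmbed_of_mem_coreRange hψ₁S
  obtain ⟨Φ₂, rfl⟩ := exists_eq_graphEmbed_of_mem_coreRange hψ₂S
  have horth : ∫ X in cellN N L, conj ((PeriodicTrialState.ofCore hL hv hW Φ₁ h₁).ψ X) *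
      (PeriodicTrialState.ofCore hL hv hW Φ₂ h₂).ψ X = 0 := by
    rw [inner_formEmbed_graphEmbed] at h₁₂
    exact h₁₂
  have hE₁ := periodicEnergy_ofCore hL hv hW Φ₁ h₁
  have hE₂ := periodicEnergy_ofCore hL hv hW Φ₂ h₂
  have hge₁ : 1 ≤ ‖graphEmbed hL hv hW Φ₁‖ ^ 2 := by
    have := norm_graphEmbed_sq_trialState hL hv hW (PeriodicTrialState.ofCore hL hv hW Φ₁ h₁)
    change ‖graphEmbed hL hv hW Φ₁‖ ^ 2 = _ at this
    rw [this]; linarith [ENNReal.toReal_nonneg (a := periodicEnergy v (PeriodicTrialState.ofCore hL hv hW Φ₁ h₁))]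
  have hge₂ : 1 ≤ ‖graphEmbed hL hv hW Φ₂‖ ^ 2 := by
    have := norm_graphEmbed_sq_trialState hL hv hW (PeriodicTrialState.ofCore hL hv hW Φ₂ h₂)
    change ‖graphEmbed hL hv hW Φ₂‖ ^ 2 = _ at this
    rw [this]; linarith [ENNReal.toReal_nonneg (a := periodicEnergy v (PeriodicTrialState.ofCore hL hv hW Φ₂ h₂))]
  change ‖graphEmbed hL hv hW Φ₁‖ ^ 2 + ‖graphEmbed hL hv hW Φ₂‖ ^ 2 < d.κ₁⁻¹ + d.κ₂⁻¹ + ε at hlt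
  calc kyFanTwo v N L
      ≤ periodicEnergy v (PeriodicTrialState.ofCore hL hv hW Φ₁ h₁) +
          periodicEnergy v (PeriodicTrialState.ofCore hL hv hW Φ₂ h₂) :=
        (iInf_le _ _).trans ((iInf_le _ _).trans (iInf_le _ horth))
    _ = ENNReal.ofReal (‖graphEmbed hL hv hW Φ₁‖ ^ 2 - 1 + (‖graphEmbed hL hv hW Φ₂‖ ^ 2 - 1)) := by
        rw [hE₁, hE₂, ← ENNReal.ofReal_add (by linarith) (by linarith)]
    _ ≤ ENNReal.ofReal (d.κ₁⁻¹ + d.κ₂⁻¹ - 2 + ε) := ENNReal.ofReal_le_ofReal (by linarith)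
    _ = ENNReal.ofReal (d.κ₁⁻¹ + d.κ₂⁻¹ - 2) + ε := by
        rw [ENNReal.ofReal_add (by linarith [twoModeData_one_le_inv_κ₁ d, twoModeData_one_le_inv_κ₂ d]) ε.coe_nonneg,
          ENNReal.ofReal_coe_nnreal]

/-- **Corollary (the first two eigenvalues of the periodic `N`-body Hamiltonian).** For `L > 0`,
`N ≥ 1` and `W ∈ L¹` of the cell there are real numbers `0 ≤ E₁ ≤ E₂` with
`periodicGroundStateEnergy v N L = E₁` and `kyFanTwo v N L = E₁ + E₂` (both infima attained in the
form domain by `L²`-orthonormal eigenvectors). [cite: ReedSimonIV1978, Thm. XIII.1–2 and XIII.64] -/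
theorem exists_two_lowest_eigenvalues (hL : 0 < L) (hv : Measurable v)
    (hW : ∫⁻ X in cellN N L, periodicInteraction v L X ≠ ⊤) (hN : 0 < N) :
    ∃ E₁ E₂ : ℝ, 0 ≤ E₁ ∧ E₁ ≤ E₂ ∧ periodicGroundStateEnergy v N L = ENNReal.ofReal E₁ ∧
      kyFanTwo v N L = ENNReal.ofReal (E₁ + E₂) := by
  obtain ⟨d⟩ := nonempty_twoModeData hL hv hW hN
  refine ⟨d.κ₁⁻¹ - 1, d.κ₂⁻¹ - 1, by linarith [twoModeData_one_le_inv_κ₁ d], ?_,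
    periodicGroundStateEnergy_eq_ofReal d, ?_⟩
  · have := (inv_le_inv₀ d.κ₁_pos d.κ₂_pos).2 d.κ₂_le_κ₁
    linarith
  · rw [kyFanTwo_eq_ofReal d]; ring_nf

end Literature.MathematicalPhysics.QuantumManyBody.BoseGas
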